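import Literature.NumberTheory.EllipticCurves.PerrinRiou2003.RankZeroSupersingularUpperBound
import Literature.NumberTheory.EllipticCurves.Wuthrich2014.ThreeAdicImageSupersingularProofs
import Summits.BirchSwinnertonDyer.Rank1Residual.Supersingular.DescentLowerBoundLevel
import HarnessLib

/-!
# Good supersingular `p`, analytic rank `0`: the UPPER half from Perrin-Riou 2003 Prop. 4.8 (Kato) —
# a REFEREED, NUMBERED source — in place of Wuthrich 2014 Prop. 21, for every per-pair consumer of
# classes X6 / X7 / X8 (cell `b2b-bsdres`, supersingular family, prover A = unit `b2b-bsdres-x10b`,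
# gen 11; class-closure N4 lead; referee question R-WU14-P21-SS)

HONEST FRAMING (run/shared/lean/b2b/bsd-rank1-residual/, verbatim in every file): the goal of the
cell is to DELETE the COMBINATION-SHAPED residual classes of the Birch–Swinnerton-Dyer formula for
ALL analytic-rank `≤ 1` elliptic curves over `ℚ` — "full BSD formula for every rank `≤ 1` curve in
class `C`" assembled STRICTLY from published theorems — so that the rank-`≤ 1` remainder becomes
exactly the CONSTRUCTION-SHAPED classes, which are TYPED (missing-input `Prop`s), NOT attempted.
This is not "finishing BSD". THEOREMS ONLY (bookkeeping over named published facts); per pair;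
NOT a class theorem; X6 / X7 / X8 stay CONSTRUCTION-SHAPED; nothing is booked here (the lane books
pairs; the referee tiers the inputs).

## Why this file exists
Every rank-`0` per-pair consumer of the supersingular family in the tree — the first-descent line
`Sel^(p)(E/ℚ) ≠ 0` (`DescentLowerBound.lean`, x10b gen 5), the level-`p^j` count
`p^{2k-1} ∣ #Sel^(p^j)(E/ℚ)` and the `81 ∣ #Sel^(9)` shape (`DescentLowerBoundLevel.lean`,
additive-p3 gen 19), and the typed halves `X6/X7/X8.bsdp_of_missingLowerBoundAt…` (`Typed/X6–X8`)
— reads its UPPER half `ord_p #Ш(E/ℚ) ≤ ord_p #Ш_an` from Wuthrich, Doc. Math. 19 (2014) Prop. 21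
(`Wuthrich2014.sha_dvd_analyticSha`, binder `hW`). The class lead of N6·O3 (additive-p3 GEN 18,
2026-08-21) raised R-WU14-P21-SS: Wuthrich's paper PROVES its Prop. 21 only off the supersingular
axis (§5; Cor. 18 "can certainly not be extended to the supersingular case"); the supersingular
clause is printed after "the usual application" with no proof. The cell's harvest seat then located
and typed (p281420, `Literature/NumberTheory/EllipticCurves/PerrinRiou2003/RankZeroSupersingularUpperBound.lean`)
a refereed NUMBERED statement of exactly the needed inequality, Tamagawa numbers included, `a_p`
arbitrary (so `a_3 = ±3` = class X8 is covered), any conductor: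

  B. Perrin-Riou, Experiment. Math. 12 (2003), **Prop. 4.8 (Kato)** (p. 162): under good
  supersingular reduction at `p`, "Si `ρ_p` est surjective et si `𝟙(L_p(E)) ≠ 0`,
  `ord_p #Ш(E/ℚ)(p) ≤ ord_p(L(E,1)/Ω_E) − ord_p(Tam(E)/#E(ℚ)²_tor)`"
  (named fact `PerrinRiou2003.prop48_padicValRat_bsd_rank_zero_le`; image hypothesis typed in
  Kato's printed form (12.5.2) `Kato2004.ImageContainsSL2 W p`; flag `PR03-Prop4.8-Kato-attribution`).

This file re-bases ALL those consumers on Prop. 4.8: each theorem below is the twin of a tree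
theorem with `(hW : sha_dvd_analyticSha)` replaced by `(h48 : prop48_padicValRat_bsd_rank_zero_le)`
and NOTHING else added — because Kato's (12.5.2) is AUTOMATIC at every pair these consumers serve:
* `p ≥ 5`: (12.5.2) ⟺ `surj(p)` (Serre IV-23; tree theorem
  `Kato2004.imageContainsSL2_of_hasSurjectiveModNGaloisRep`), and `surj(p)` is automatic on X6
  (`ClassX6.surj`, Serre 1972 Props. 12 + 21 i)) and is the per-pair datum `hs` on X7;
* `p = 3` at a GOOD SUPERSINGULAR `3` (X6 with `a_3 = 0`, X7 at `3`, X8): `surj(3) ⇒` every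
  `ρ̄_{E,3ⁿ}` onto — Wuthrich 2014 Lemma 20, PROVED in the tree by a local argument at `3`
  (`Kato2004.imageContainsSL2_of_goodSupersingular_three_of_surj`, lit-kato / harvest-1), so again
  `surj(3)` suffices, and `surj(3)` is automatic on X6 and on X8 ∩ {sst} (`ClassX8.surj_of_semistable`).
So the re-based consumers have the SAME binders as the originals, minus `hW`, plus `h48`.

What this buys: the class-closure cells whose per-pair certificate is a `3`-descent (N4@3: 13 DESC3
cells + 3 G29 rows; N5@3 / N6: the `T-full3` / `desc3surj` rows) and every `T-KATO-CT`-shaped booking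
can cite a refereed numbered proposition for the upper half. Nothing is booked here (R-WU14-P21-SS).
## Contents
§1 Kato's (12.5.2) at the family's pairs; §2 typed halves `…_of_prop48`; §3 first-descent consumers;
§4 level-count consumers and the `81 ∣ #Sel^(9)` shapes at `p = 3` — X6 / X7 / X8 throughout.

References: [PerrinRiou2003] Prop. 4.8 (p. 162); [Kato2004Asterisque] (12.5.2) (p. 222); [Wuthrich2014]
Lemma 20, Prop. 21; [Serre1972] Props. 12, 21 i); [SerreAbelianLadic1968] IV-23; [SilvermanAEC2009] X.4.14;
[Sprung2024] Cor. 1.3; [Miller2011LMS] Def. 1.1.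
-/

noncomputable section

open scoped Classical

open WeierstrassCurve Literature.NumberTheory.EllipticCurves
  Literature.NumberTheory.EllipticCurves.Rank1Residual
  Literature.NumberTheory.EllipticCurves.Rank1Residual.Typed
  Literature.NumberTheory.EllipticCurves.PerrinRiou2003

namespace Summit.BirchSwinnertonDyer.Rank1Residual.Supersingular

variable (W : WeierstrassCurve ℚ) [W.IsElliptic] [W.IsGloballyMinimal] (p : ℕ) [Fact p.Prime]

/-! ### §1. Kato's (12.5.2) is automatic at the family's pairs -/

/-- **Kato's (12.5.2) at an odd good supersingular prime from the census bit `surj(p)`.** For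
`p ≥ 5` this is Serre's IV-23 lemma (`Kato2004.imageContainsSL2_of_hasSurjectiveModNGaloisRep`); at
`p = 3` it is Wuthrich 2014 Lemma 20 in the good supersingular case, PROVED in the tree
(`Kato2004.imageContainsSL2_of_goodSupersingular_three_of_surj`: the inertia group at `3` acts on
`E[9]` through a group of order divisible by `72`). [cite: Kato2004Asterisque, (12.5.2) in Thm. 12.5 (4) (p. 222)]
[cite: Wuthrich2014, Lemma 20 (p. 399)] [cite: SerreAbelianLadic1968, Ch. IV §3.4, Lemma 3 (IV-23)] -/
theorem imageContainsSL2_of_goodSS_of_surj (hp : p ≠ 2) (hss : GoodSS W p) (hs : Surj W p) :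
    Kato2004.ImageContainsSL2 W p := by
  by_cases h3 : p = 3
  · subst h3
    exact Kato2004.imageContainsSL2_of_goodSupersingular_three_of_surj W hss.1 hss.2 hs
  · have h5 : 5 ≤ p := by
      have h2 := (Fact.out : p.Prime).two_le
      have h4 : p ≠ 4 := fun h ↦ by
        have := (Fact.out : p.Prime).eq_one_or_self_of_dvd 2 (by rw [h]; norm_num)
        omega
      omega
    exact Kato2004.imageContainsSL2_of_hasSurjectiveModNGaloisRep W p h5 hs

/-- **X6 ⇒ Kato's (12.5.2) at every odd `p`** (`surj(p)` by `ClassX6.surj`: Serre Props. 12 + 21 i);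
then `imageContainsSL2_of_goodSS_of_surj`). [cite: Serre1972, §5.4 Prop. 21 i)]
[cite: Kato2004Asterisque, (12.5.2) in Thm. 12.5 (4) (p. 222)] [cite: Wuthrich2014, Lemma 20 (p. 399)] -/
theorem ClassX6.imageContainsSL2 (hp : p ≠ 2) (hX : ClassX6 W p) : Kato2004.ImageContainsSL2 W p :=
  imageContainsSL2_of_goodSS_of_surj W p hp hX.1 (ClassX6.surj W p hp hX)

/-- **X7 ∩ {surj(p)} ⇒ Kato's (12.5.2) at every odd `p`.** [cite: Kato2004Asterisque, (12.5.2) in Thm. 12.5 (4) (p. 222)]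
[cite: Wuthrich2014, Lemma 20 (p. 399)] -/
theorem ClassX7.imageContainsSL2_of_surj (hp : p ≠ 2) (hX : ClassX7 W p) (hs : Surj W p) :
    Kato2004.ImageContainsSL2 W p :=
  imageContainsSL2_of_goodSS_of_surj W p hp hX.1 hs

/-- **X8 ∩ {surj(3)} ⇒ Kato's (12.5.2) at `p` (`= 3`)** (good supersingular `3` with `a_3 = ±3`:
`3 ∣ a_3`, so Wuthrich's Lemma 20 applies verbatim). [cite: Kato2004Asterisque, (12.5.2) in Thm. 12.5 (4) (p. 222)]
[cite: Wuthrich2014, Lemma 20 (p. 399)] -/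
theorem ClassX8.imageContainsSL2_of_surj (hX : ClassX8 W p) (hs : Surj W p) :
    Kato2004.ImageContainsSL2 W p := by
  obtain ⟨rfl, hss, _⟩ := hX
  exact imageContainsSL2_of_goodSS_of_surj W 3 (by decide) hss hs

/-- **X8 ∩ {sst} ⇒ Kato's (12.5.2) at `p` (`= 3`)**, no image binder (`ClassX8.surj_of_semistable`,
Serre §5.4 Prop. 21 i)). [cite: Serre1972, §5.4 Prop. 21 i)] [cite: Wuthrich2014, Lemma 20 (p. 399)] -/
theorem ClassX8.imageContainsSL2_of_semistable (hX : ClassX8 W p) (hsst : Semistable W) :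
    Kato2004.ImageContainsSL2 W p := by
  have hs3 : Surj W 3 := ClassX8.surj_of_semistable W p hX hsst
  obtain ⟨rfl, hss, _⟩ := hX
  exact imageContainsSL2_of_goodSS_of_surj W 3 (by decide) hss hs3

/-! ### §2. The typed halves, re-based on Prop. 4.8 -/

/-- **X6 ∩ {r_an = 0}, odd `p`: the UPPER half `ord_p #Ш ≤ ord_p #Ш_an` from Perrin-Riou 2003
Prop. 4.8 (Kato)** — `h48` + GZK + modularity; image hypothesis automatic (`ClassX6.imageContainsSL2`).
The twin of the Wuthrich-based upper half inside `X6.MissingInputAt`. [cite: PerrinRiou2003, Prop. 4.8 (p. 162)]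
[cite: Serre1972, §5.4 Prop. 21 i)] [cite: Miller2011LMS, Def. 1.1] -/
theorem X6.missingUpperBoundAt_of_prop48 (h48 : prop48_padicValRat_bsd_rank_zero_le)
    (hGZK : rank_eq_analyticRank_of_analyticRank_le_one) (hmod : hasEntireLFunction_rat)
    (hp : p ≠ 2) (hX : ClassX6 W p) (hr : W.analyticRank = 0) : MissingUpperBoundAt W p :=
  PerrinRiou2003.missingUpperBoundAt_of_prop48 W p h48 hGZK hmod hp hX.1
    (ClassX6.imageContainsSL2 W p hp hX) hr

/-- **X6 ∩ {r_an = 0}, odd `p`: `BSD(E,p)` from the missing LOWER bound alone, upper half from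
Prop. 4.8** — the twin of `Typed.X6.bsdp_of_missingLowerBoundAt_of_analyticRank_eq_zero` with `hW`
replaced by `h48`. [cite: PerrinRiou2003, Prop. 4.8 (p. 162)] [cite: Serre1972, §5.4 Prop. 21 i)]
[cite: Miller2011LMS, §1 and Def. 1.1] -/
theorem X6.bsdp_of_missingLowerBoundAt_of_prop48 (h48 : prop48_padicValRat_bsd_rank_zero_le)
    (hGZK : rank_eq_analyticRank_of_analyticRank_le_one) (hmod : hasEntireLFunction_rat)
    (hp : p ≠ 2) (hX : ClassX6 W p) (hr : W.analyticRank = 0) (hlow : MissingLowerBoundAt W p) :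
    BSDp W p :=
  PerrinRiou2003.bsdp_of_missingLowerBoundAt_of_prop48 W p h48 hGZK hmod hp hX.1
    (ClassX6.imageContainsSL2 W p hp hX) hr hlow

/-- **X6 at an odd prime, analytic rank `≤ 1`: `BSD(E,p)` from the missing LOWER bound alone in BOTH
ranks, refereed NUMBERED inputs only** — rank `0`: Perrin-Riou 2003 Prop. 4.8 (`h48`); rank `1`:
Sprung 2024 Cor. 1.3 (ii) (`hS`, via `X6.bsdp_of_missingLowerBoundAt_of_analyticRank_eq_one`). The
twin of `X6.bsdp_of_missingLowerBoundAt` (harvest-1) with `hW` replaced by `h48`.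
[cite: PerrinRiou2003, Prop. 4.8 (p. 162)] [cite: Sprung2024, Cor. 1.3 (p. 5), second sentence]
[cite: Miller2011LMS, §1 and Def. 1.1] -/
theorem X6.bsdp_of_missingLowerBoundAt_of_prop48_of_sprung
    (h48 : prop48_padicValRat_bsd_rank_zero_le) (hS : Sprung2024.cor13_padicValRat_bsd_rank_one_le)
    (hGZK : rank_eq_analyticRank_of_analyticRank_le_one) (hmod : hasEntireLFunction_rat)
    (hp : p ≠ 2) (hX : ClassX6 W p) (hr : W.analyticRank ≤ 1) (hlow : MissingLowerBoundAt W p) :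
    BSDp W p := by
  rcases Nat.lt_or_ge W.analyticRank 1 with h0 | h1
  · exact X6.bsdp_of_missingLowerBoundAt_of_prop48 W p h48 hGZK hmod hp hX (by omega) hlow
  · exact X6.bsdp_of_missingLowerBoundAt_of_analyticRank_eq_one W p hS hGZK hmod hp hX (by omega)
      hlow

/-- **X7 ∩ {r_an = 0} ∩ {surj(p)}, odd `p`: `BSD(E,p)` from the missing LOWER bound alone, upper
half from Prop. 4.8** — the twin of `Typed.X7.bsdp_of_missingLowerBoundAt_of_surj` with `hW` replaced
by `h48` (same per-pair image datum `hs`). [cite: PerrinRiou2003, Prop. 4.8 (p. 162)]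
[cite: Wuthrich2014, Lemma 20 (p. 399)] [cite: Miller2011LMS, §1 and Def. 1.1] -/
theorem X7.bsdp_of_missingLowerBoundAt_of_prop48_of_surj (h48 : prop48_padicValRat_bsd_rank_zero_le)
    (hGZK : rank_eq_analyticRank_of_analyticRank_le_one) (hmod : hasEntireLFunction_rat)
    (hp : p ≠ 2) (hX : ClassX7 W p) (hs : Surj W p) (hr : W.analyticRank = 0)
    (hlow : MissingLowerBoundAt W p) : BSDp W p :=
  PerrinRiou2003.bsdp_of_missingLowerBoundAt_of_prop48 W p h48 hGZK hmod hp hX.1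
    (ClassX7.imageContainsSL2_of_surj W p hp hX hs) hr hlow

/-- **X8 ∩ {r_an = 0} ∩ {surj(3)}: `BSD(E,p)` (`p = 3`) from the missing LOWER bound alone, upper
half from Prop. 4.8 (`a_3 = ±3` is inside its scope: `3 ∣ a_3`)** — the twin of
`Typed.X8.bsdp_of_missingLowerBoundAt_of_surj` with `hW` replaced by `h48`.
[cite: PerrinRiou2003, Prop. 4.8 (p. 162)] [cite: Wuthrich2014, Lemma 20 (p. 399)] [cite: Miller2011LMS, §1 and Def. 1.1] -/
theorem X8.bsdp_of_missingLowerBoundAt_of_prop48_of_surj (h48 : prop48_padicValRat_bsd_rank_zero_le)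
    (hGZK : rank_eq_analyticRank_of_analyticRank_le_one) (hmod : hasEntireLFunction_rat)
    (hX : ClassX8 W p) (hs : Surj W p) (hr : W.analyticRank = 0) (hlow : MissingLowerBoundAt W p) :
    BSDp W p := by
  have himg := ClassX8.imageContainsSL2_of_surj W p hX hs
  obtain ⟨rfl, hss, _⟩ := hX
  exact PerrinRiou2003.bsdp_of_missingLowerBoundAt_of_prop48 W 3 h48 hGZK hmod (by decide) hss himg hr
    hlow

/-- **X8 ∩ {sst} ∩ {r_an = 0}: `BSD(E,p)` (`p = 3`) from the missing LOWER bound alone, upper half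
from Prop. 4.8, NO image binder** — the twin of `Typed.X8.bsdp_of_missingLowerBoundAt_of_semistable`.
[cite: PerrinRiou2003, Prop. 4.8 (p. 162)] [cite: Serre1972, §5.4 Prop. 21 i)] [cite: Miller2011LMS, §1 and Def. 1.1] -/
theorem X8.bsdp_of_missingLowerBoundAt_of_prop48_of_semistable
    (h48 : prop48_padicValRat_bsd_rank_zero_le)
    (hGZK : rank_eq_analyticRank_of_analyticRank_le_one) (hmod : hasEntireLFunction_rat)
    (hX : ClassX8 W p) (hsst : Semistable W) (hr : W.analyticRank = 0)
    (hlow : MissingLowerBoundAt W p) : BSDp W p :=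
  X8.bsdp_of_missingLowerBoundAt_of_prop48_of_surj W p h48 hGZK hmod hX
    (hX.1 ▸ ClassX8.surj_of_semistable W p hX hsst) hr hlow

/-! ### §3. First-descent consumers (`Sel^(p)(E/ℚ) ≠ 0`, `ord_p #Ш_an ≤ 2`), re-based -/

/-- **X6 ∩ {r_an = 0}, odd `p`, `ord_p #Ш_an ≤ 2`: `BSD(E,p)` from PUBLISHED theorems + the native
certificate line `Sel^(p)(E/ℚ) ≠ 0`, upper half from Prop. 4.8** — the twin of
`X6.bsdp_rankZero_of_casselsTate_of_selmerGroup_ne_bot` (x10b gen 5) with `hW` replaced by `h48`.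
Census instances: the 13 N4@3 DESC3 cells (`X678DescentRecords`, `DescentLowerBoundRecordsX6B`) and
the G29 rows `336878b1`, `432791a1`, `496987b1` (`DescentLowerBoundRecordsG29`), each `dim Sel₃ = 2` on
two engines. Per-pair; NOT a class theorem. [cite: PerrinRiou2003, Prop. 4.8 (p. 162)]
[cite: SilvermanAEC2009, Thm. X.4.14] [cite: Serre1972, §1.11 Prop. 12 and §5.4 Prop. 21 i)]
[cite: Miller2011LMS, §1 and Def. 1.1] -/
theorem X6.bsdp_rankZero_of_casselsTate_of_selmerGroup_ne_bot_of_prop48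
    (hCT : exists_casselsTate_pairing (K := ℚ)) (h48 : prop48_padicValRat_bsd_rank_zero_le)
    (hGZK : rank_eq_analyticRank_of_analyticRank_le_one) (hmod : hasEntireLFunction_rat)
    (hp : p ≠ 2) (hX : ClassX6 W p) (hr : W.analyticRank = 0)
    {q : ℚ} (hq : shaAn W = (q : ℂ)) (hv : padicValRat p q ≤ 2)
    (hSel : W.selmerGroup (p : ℤ) ≠ ⊥) : BSDp W p :=
  X6.bsdp_of_missingLowerBoundAt_of_prop48 W p h48 hGZK hmod hp hX hr
    (missingLowerBoundAt_of_casselsTate_of_selmerGroup_ne_bot W p hCT hGZK hr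
      (not_dvd_torsionOrder_of_irr W p (ClassX6.irr W p hp hX)) hq hv hSel)

/-- **X7 ∩ {r_an = 0} ∩ {surj(p)}, odd `p`, `ord_p #Ш_an ≤ 2`: `BSD(E,p)` from PUBLISHED theorems +
`Sel^(p)(E/ℚ) ≠ 0`, upper half from Prop. 4.8** — the twin of
`X7.bsdp_rankZero_of_casselsTate_of_selmerGroup_ne_bot_of_surj`. Census instances: the rank-`0` X7 rows
of `T-full3` / `desc3surj` (two engines). [cite: PerrinRiou2003, Prop. 4.8 (p. 162)]
[cite: SilvermanAEC2009, Thm. X.4.14] [cite: Serre1972, §1.11 Prop. 12] [cite: Miller2011LMS, §1 and Def. 1.1] -/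
theorem X7.bsdp_rankZero_of_casselsTate_of_selmerGroup_ne_bot_of_prop48_of_surj
    (hCT : exists_casselsTate_pairing (K := ℚ)) (h48 : prop48_padicValRat_bsd_rank_zero_le)
    (hGZK : rank_eq_analyticRank_of_analyticRank_le_one) (hmod : hasEntireLFunction_rat)
    (hp : p ≠ 2) (hX : ClassX7 W p) (hs : Surj W p) (hr : W.analyticRank = 0)
    {q : ℚ} (hq : shaAn W = (q : ℂ)) (hv : padicValRat p q ≤ 2)
    (hSel : W.selmerGroup (p : ℤ) ≠ ⊥) : BSDp W p :=
  X7.bsdp_of_missingLowerBoundAt_of_prop48_of_surj W p h48 hGZK hmod hp hX hs hr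
    (missingLowerBoundAt_of_casselsTate_of_selmerGroup_ne_bot W p hCT hGZK hr
      (not_dvd_torsionOrder_of_irr W p (ClassX7.irr W p hp hX)) hq hv hSel)

/-- **X8 ∩ {r_an = 0} ∩ {surj(3)}, `ord_3 #Ш_an ≤ 2`: `BSD(E,3)` from PUBLISHED theorems +
`Sel^(3)(E/ℚ) ≠ 0`, upper half from Prop. 4.8** — the twin of
`X8.bsdp_rankZero_of_casselsTate_of_selmerGroup_ne_bot_of_surj`. [cite: PerrinRiou2003, Prop. 4.8 (p. 162)]
[cite: SilvermanAEC2009, Thm. X.4.14] [cite: Serre1972, §1.11 Prop. 12] [cite: Miller2011LMS, §1 and Def. 1.1] -/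
theorem X8.bsdp_rankZero_of_casselsTate_of_selmerGroup_ne_bot_of_prop48_of_surj
    (hCT : exists_casselsTate_pairing (K := ℚ)) (h48 : prop48_padicValRat_bsd_rank_zero_le)
    (hGZK : rank_eq_analyticRank_of_analyticRank_le_one) (hmod : hasEntireLFunction_rat)
    (hX : ClassX8 W p) (hs : Surj W p) (hr : W.analyticRank = 0)
    {q : ℚ} (hq : shaAn W = (q : ℂ)) (hv : padicValRat p q ≤ 2)
    (hSel : W.selmerGroup (p : ℤ) ≠ ⊥) : BSDp W p :=
  X8.bsdp_of_missingLowerBoundAt_of_prop48_of_surj W p h48 hGZK hmod hX hs hr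
    (missingLowerBoundAt_of_casselsTate_of_selmerGroup_ne_bot W p hCT hGZK hr
      (not_dvd_torsionOrder_of_irr W p (ClassX8.irr' W p hX)) hq hv hSel)

/-- **X8 ∩ {sst} ∩ {r_an = 0}, `ord_3 #Ш_an ≤ 2`: `BSD(E,3)` from PUBLISHED theorems +
`Sel^(3)(E/ℚ) ≠ 0`, upper half from Prop. 4.8, NO image binder** — the twin of
`X8.bsdp_rankZero_of_casselsTate_of_selmerGroup_ne_bot_of_semistable`. [cite: PerrinRiou2003, Prop. 4.8 (p. 162)]
[cite: SilvermanAEC2009, Thm. X.4.14] [cite: Serre1972, §1.11 Prop. 12 and §5.4 Prop. 21 i)]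
[cite: Miller2011LMS, §1 and Def. 1.1] -/
theorem X8.bsdp_rankZero_of_casselsTate_of_selmerGroup_ne_bot_of_prop48_of_semistable
    (hCT : exists_casselsTate_pairing (K := ℚ)) (h48 : prop48_padicValRat_bsd_rank_zero_le)
    (hGZK : rank_eq_analyticRank_of_analyticRank_le_one) (hmod : hasEntireLFunction_rat)
    (hX : ClassX8 W p) (hsst : Semistable W) (hr : W.analyticRank = 0)
    {q : ℚ} (hq : shaAn W = (q : ℂ)) (hv : padicValRat p q ≤ 2)
    (hSel : W.selmerGroup (p : ℤ) ≠ ⊥) : BSDp W p :=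
  X8.bsdp_of_missingLowerBoundAt_of_prop48_of_semistable W p h48 hGZK hmod hX hsst hr
    (missingLowerBoundAt_of_casselsTate_of_selmerGroup_ne_bot W p hCT hGZK hr
      (not_dvd_torsionOrder_of_irr W p (ClassX8.irr' W p hX)) hq hv hSel)

/-! ### §4. Level-count consumers (`p^{2k-1} ∣ #Sel^(p^j)(E/ℚ)`, `ord_p #Ш_an ≤ 2k`), re-based -/

/-- **X6 ∩ {r_an = 0}, odd `p`, `ord_p #Ш_an ≤ 2k`: `BSD(E,p)` from PUBLISHED theorems + the count
certificate `p^{2k−1} ∣ #Sel^(p^j)(E/ℚ)`, upper half from Prop. 4.8** — the twin of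
`X6.bsdp_rankZero_of_casselsTate_of_dvd_card_selmerGroup_pow` (additive-p3 gen 19).
[cite: PerrinRiou2003, Prop. 4.8 (p. 162)] [cite: SilvermanAEC2009, Thm. X.4.14]
[cite: Serre1972, §1.11 Prop. 12 and §5.4 Prop. 21 i)] [cite: Miller2011LMS, §1 and Def. 1.1] -/
theorem X6.bsdp_rankZero_of_casselsTate_of_dvd_card_selmerGroup_pow_of_prop48
    (hCT : exists_casselsTate_pairing (K := ℚ)) (h48 : prop48_padicValRat_bsd_rank_zero_le)
    (hGZK : rank_eq_analyticRank_of_analyticRank_le_one) (hmod : hasEntireLFunction_rat)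
    (hp : p ≠ 2) (hX : ClassX6 W p) (hr : W.analyticRank = 0) (j : ℕ)
    {q : ℚ} (hq : shaAn W = (q : ℂ)) {k : ℕ} (hv : padicValRat p q ≤ 2 * k)
    (hcard : p ^ (2 * k - 1) ∣ Nat.card (W.selmerGroup ((p ^ j : ℕ) : ℤ))) : BSDp W p :=
  X6.bsdp_of_missingLowerBoundAt_of_prop48 W p h48 hGZK hmod hp hX hr
    (missingLowerBoundAt_of_casselsTate_of_dvd_card_selmerGroup_pow W p hCT hGZK (by omega) j
      (not_dvd_torsionOrder_of_irr W p (ClassX6.irr W p hp hX)) hq hv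
      (by rw [hr, mul_zero, zero_add]; exact hcard))

/-- **X7 ∩ {r_an = 0} ∩ {surj(p)}, odd `p`, `ord_p #Ш_an ≤ 2k`: `BSD(E,p)` from PUBLISHED theorems +
`p^{2k−1} ∣ #Sel^(p^j)(E/ℚ)`, upper half from Prop. 4.8** — the twin of
`X7.bsdp_rankZero_of_casselsTate_of_dvd_card_selmerGroup_pow_of_surj`. [cite: PerrinRiou2003, Prop. 4.8 (p. 162)]
[cite: SilvermanAEC2009, Thm. X.4.14] [cite: Serre1972, §1.11 Prop. 12] [cite: Miller2011LMS, §1 and Def. 1.1] -/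
theorem X7.bsdp_rankZero_of_casselsTate_of_dvd_card_selmerGroup_pow_of_prop48_of_surj
    (hCT : exists_casselsTate_pairing (K := ℚ)) (h48 : prop48_padicValRat_bsd_rank_zero_le)
    (hGZK : rank_eq_analyticRank_of_analyticRank_le_one) (hmod : hasEntireLFunction_rat)
    (hp : p ≠ 2) (hX : ClassX7 W p) (hs : Surj W p) (hr : W.analyticRank = 0) (j : ℕ)
    {q : ℚ} (hq : shaAn W = (q : ℂ)) {k : ℕ} (hv : padicValRat p q ≤ 2 * k)
    (hcard : p ^ (2 * k - 1) ∣ Nat.card (W.selmerGroup ((p ^ j : ℕ) : ℤ))) : BSDp W p :=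
  X7.bsdp_of_missingLowerBoundAt_of_prop48_of_surj W p h48 hGZK hmod hp hX hs hr
    (missingLowerBoundAt_of_casselsTate_of_dvd_card_selmerGroup_pow W p hCT hGZK (by omega) j
      (not_dvd_torsionOrder_of_irr W p (ClassX7.irr W p hp hX)) hq hv
      (by rw [hr, mul_zero, zero_add]; exact hcard))

/-- **X8 ∩ {r_an = 0} ∩ {surj(3)}, `ord_3 #Ш_an ≤ 2k`: `BSD(E,3)` from PUBLISHED theorems +
`3^{2k−1} ∣ #Sel^(3^j)(E/ℚ)`, upper half from Prop. 4.8** — the twin of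
`X8.bsdp_rankZero_of_casselsTate_of_dvd_card_selmerGroup_pow_of_surj`. [cite: PerrinRiou2003, Prop. 4.8 (p. 162)]
[cite: SilvermanAEC2009, Thm. X.4.14] [cite: Serre1972, §1.11 Prop. 12] [cite: Miller2011LMS, §1 and Def. 1.1] -/
theorem X8.bsdp_rankZero_of_casselsTate_of_dvd_card_selmerGroup_pow_of_prop48_of_surj
    (hCT : exists_casselsTate_pairing (K := ℚ)) (h48 : prop48_padicValRat_bsd_rank_zero_le)
    (hGZK : rank_eq_analyticRank_of_analyticRank_le_one) (hmod : hasEntireLFunction_rat)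
    (hX : ClassX8 W p) (hs : Surj W p) (hr : W.analyticRank = 0) (j : ℕ)
    {q : ℚ} (hq : shaAn W = (q : ℂ)) {k : ℕ} (hv : padicValRat p q ≤ 2 * k)
    (hcard : p ^ (2 * k - 1) ∣ Nat.card (W.selmerGroup ((p ^ j : ℕ) : ℤ))) : BSDp W p :=
  X8.bsdp_of_missingLowerBoundAt_of_prop48_of_surj W p h48 hGZK hmod hX hs hr
    (missingLowerBoundAt_of_casselsTate_of_dvd_card_selmerGroup_pow W p hCT hGZK (by omega) j
      (not_dvd_torsionOrder_of_irr W p (ClassX8.irr' W p hX)) hq hv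
      (by rw [hr, mul_zero, zero_add]; exact hcard))

/-- **X8 ∩ {sst} ∩ {r_an = 0}, `ord_3 #Ш_an ≤ 2k`: `BSD(E,3)` from PUBLISHED theorems +
`3^{2k−1} ∣ #Sel^(3^j)(E/ℚ)`, upper half from Prop. 4.8, NO image binder** — the twin of
`X8.bsdp_rankZero_of_casselsTate_of_dvd_card_selmerGroup_pow_of_semistable`.
[cite: PerrinRiou2003, Prop. 4.8 (p. 162)] [cite: SilvermanAEC2009, Thm. X.4.14]
[cite: Serre1972, §1.11 Prop. 12 and §5.4 Prop. 21 i)] [cite: Miller2011LMS, §1 and Def. 1.1] -/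
theorem X8.bsdp_rankZero_of_casselsTate_of_dvd_card_selmerGroup_pow_of_prop48_of_semistable
    (hCT : exists_casselsTate_pairing (K := ℚ)) (h48 : prop48_padicValRat_bsd_rank_zero_le)
    (hGZK : rank_eq_analyticRank_of_analyticRank_le_one) (hmod : hasEntireLFunction_rat)
    (hX : ClassX8 W p) (hsst : Semistable W) (hr : W.analyticRank = 0) (j : ℕ)
    {q : ℚ} (hq : shaAn W = (q : ℂ)) {k : ℕ} (hv : padicValRat p q ≤ 2 * k)
    (hcard : p ^ (2 * k - 1) ∣ Nat.card (W.selmerGroup ((p ^ j : ℕ) : ℤ))) : BSDp W p :=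
  X8.bsdp_of_missingLowerBoundAt_of_prop48_of_semistable W p h48 hGZK hmod hX hsst hr
    (missingLowerBoundAt_of_casselsTate_of_dvd_card_selmerGroup_pow W p hCT hGZK (by omega) j
      (not_dvd_torsionOrder_of_irr W p (ClassX8.irr' W p hX)) hq hv
      (by rw [hr, mul_zero, zero_add]; exact hcard))

/-- **X6 ∩ {r_an = 0} ∩ {ord_3 #Ш_an ≤ 4} at `p = 3`: `BSD(E,3)` from PUBLISHED theorems + the
level-`9` count `81 ∣ #Sel^(9)(E/ℚ)`, upper half from Prop. 4.8** — the twin of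
`X6.bsdp_three_rankZero_of_card_selmerNine` (census targets: N4@3's 3 cells `152330l1`, `271726d1`,
`405130d1` with `#Ш_an = 81·u`). [cite: PerrinRiou2003, Prop. 4.8 (p. 162)]
[cite: SilvermanAEC2009, Thm. X.4.2(a) and X.4.14] [cite: Miller2011LMS, §1 and Def. 1.1] -/
theorem X6.bsdp_three_rankZero_of_card_selmerNine_of_prop48 [Fact (Nat.Prime 3)]
    (hCT : exists_casselsTate_pairing (K := ℚ)) (h48 : prop48_padicValRat_bsd_rank_zero_le)
    (hGZK : rank_eq_analyticRank_of_analyticRank_le_one) (hmod : hasEntireLFunction_rat)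
    (hX : ClassX6 W 3) (hr : W.analyticRank = 0)
    {q : ℚ} (hq : shaAn W = (q : ℂ)) (hv : padicValRat 3 q ≤ 4)
    (hcard : 81 ∣ Nat.card (W.selmerGroup (9 : ℤ))) : BSDp W 3 := by
  have h9 : ((3 ^ 2 : ℕ) : ℤ) = 9 := by norm_num
  have hcard' : 3 ^ (2 * 2 - 1) ∣ Nat.card (W.selmerGroup ((3 ^ 2 : ℕ) : ℤ)) := by
    rw [h9]; exact dvd_trans (by norm_num) hcard
  exact X6.bsdp_rankZero_of_casselsTate_of_dvd_card_selmerGroup_pow_of_prop48 W 3 hCT h48 hGZK hmod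
    (by norm_num) hX hr 2 hq (k := 2) (by norm_num; exact hv) hcard'

/-- **X7 ∩ {r_an = 0} ∩ {surj(3)} ∩ {ord_3 #Ш_an ≤ 4}: `BSD(E,3)` from PUBLISHED theorems +
`81 ∣ #Sel^(9)(E/ℚ)`, upper half from Prop. 4.8** — the twin of
`X7.bsdp_three_rankZero_of_card_selmerNine_of_surj` (census targets: N5@3's 11 `#Ш_an = 81·u` cells).
[cite: PerrinRiou2003, Prop. 4.8 (p. 162)] [cite: SilvermanAEC2009, Thm. X.4.2(a) and X.4.14]
[cite: Miller2011LMS, §1 and Def. 1.1] -/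
theorem X7.bsdp_three_rankZero_of_card_selmerNine_of_prop48_of_surj [Fact (Nat.Prime 3)]
    (hCT : exists_casselsTate_pairing (K := ℚ)) (h48 : prop48_padicValRat_bsd_rank_zero_le)
    (hGZK : rank_eq_analyticRank_of_analyticRank_le_one) (hmod : hasEntireLFunction_rat)
    (hX : ClassX7 W 3) (hs : Surj W 3) (hr : W.analyticRank = 0)
    {q : ℚ} (hq : shaAn W = (q : ℂ)) (hv : padicValRat 3 q ≤ 4)
    (hcard : 81 ∣ Nat.card (W.selmerGroup (9 : ℤ))) : BSDp W 3 := by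
  have h9 : ((3 ^ 2 : ℕ) : ℤ) = 9 := by norm_num
  have hcard' : 3 ^ (2 * 2 - 1) ∣ Nat.card (W.selmerGroup ((3 ^ 2 : ℕ) : ℤ)) := by
    rw [h9]; exact dvd_trans (by norm_num) hcard
  exact X7.bsdp_rankZero_of_casselsTate_of_dvd_card_selmerGroup_pow_of_prop48_of_surj W 3 hCT h48
    hGZK hmod (by norm_num) hX hs hr 2 hq (k := 2) (by norm_num; exact hv) hcard'

/-- **X8 ∩ {r_an = 0} ∩ {surj(3)} ∩ {ord_3 #Ш_an ≤ 4}: `BSD(E,3)` from PUBLISHED theorems +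
`81 ∣ #Sel^(9)(E/ℚ)`, upper half from Prop. 4.8** — the twin of
`X8.bsdp_three_rankZero_of_card_selmerNine_of_surj` (census targets: N6's 33 `#Ш_an = 81·u` cells).
[cite: PerrinRiou2003, Prop. 4.8 (p. 162)] [cite: SilvermanAEC2009, Thm. X.4.2(a) and X.4.14]
[cite: Miller2011LMS, §1 and Def. 1.1] -/
theorem X8.bsdp_three_rankZero_of_card_selmerNine_of_prop48_of_surj [Fact (Nat.Prime 3)]
    (hCT : exists_casselsTate_pairing (K := ℚ)) (h48 : prop48_padicValRat_bsd_rank_zero_le)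
    (hGZK : rank_eq_analyticRank_of_analyticRank_le_one) (hmod : hasEntireLFunction_rat)
    (hX : ClassX8 W 3) (hs : Surj W 3) (hr : W.analyticRank = 0)
    {q : ℚ} (hq : shaAn W = (q : ℂ)) (hv : padicValRat 3 q ≤ 4)
    (hcard : 81 ∣ Nat.card (W.selmerGroup (9 : ℤ))) : BSDp W 3 := by
  have h9 : ((3 ^ 2 : ℕ) : ℤ) = 9 := by norm_num
  have hcard' : 3 ^ (2 * 2 - 1) ∣ Nat.card (W.selmerGroup ((3 ^ 2 : ℕ) : ℤ)) := by
    rw [h9]; exact dvd_trans (by norm_num) hcard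
  exact X8.bsdp_rankZero_of_casselsTate_of_dvd_card_selmerGroup_pow_of_prop48_of_surj W 3 hCT h48
    hGZK hmod hX hs hr 2 hq (k := 2) (by norm_num; exact hv) hcard'

/-- **X8 ∩ {sst} ∩ {r_an = 0} ∩ {ord_3 #Ш_an ≤ 4}: `BSD(E,3)` from PUBLISHED theorems +
`81 ∣ #Sel^(9)(E/ℚ)`, upper half from Prop. 4.8, NO image binder** — the twin of
`X8.bsdp_three_rankZero_of_card_selmerNine_of_semistable`. [cite: PerrinRiou2003, Prop. 4.8 (p. 162)]
[cite: SilvermanAEC2009, Thm. X.4.2(a) and X.4.14] [cite: Miller2011LMS, §1 and Def. 1.1] -/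
theorem X8.bsdp_three_rankZero_of_card_selmerNine_of_prop48_of_semistable [Fact (Nat.Prime 3)]
    (hCT : exists_casselsTate_pairing (K := ℚ)) (h48 : prop48_padicValRat_bsd_rank_zero_le)
    (hGZK : rank_eq_analyticRank_of_analyticRank_le_one) (hmod : hasEntireLFunction_rat)
    (hX : ClassX8 W 3) (hsst : Semistable W) (hr : W.analyticRank = 0)
    {q : ℚ} (hq : shaAn W = (q : ℂ)) (hv : padicValRat 3 q ≤ 4)
    (hcard : 81 ∣ Nat.card (W.selmerGroup (9 : ℤ))) : BSDp W 3 := by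
  have h9 : ((3 ^ 2 : ℕ) : ℤ) = 9 := by norm_num
  have hcard' : 3 ^ (2 * 2 - 1) ∣ Nat.card (W.selmerGroup ((3 ^ 2 : ℕ) : ℤ)) := by
    rw [h9]; exact dvd_trans (by norm_num) hcard
  exact X8.bsdp_rankZero_of_casselsTate_of_dvd_card_selmerGroup_pow_of_prop48_of_semistable W 3 hCT
    h48 hGZK hmod hX hsst hr 2 hq (k := 2) (by norm_num; exact hv) hcard'

end Summit.BirchSwinnertonDyer.Rank1Residual.Supersingular

end
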